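import Summits.BirchSwinnertonDyer.BirchSwinnertonDyer.Theorems.EisensteinPrimesFullDescentSpecPieces
import Summits.BirchSwinnertonDyer.BirchSwinnertonDyer.Theorems.EisensteinPrimesFullDescentTheoremAII
import HarnessLib

/-!
# Crux 2 `GoodLatticeBDPValue` (stmt-BirchSwinnertonDyer-19032), line `halves` v21 — **STUB 3a-B
# `stub_fullDescentAtThreeOfRed` (Theorem T′) CLOSED**

Cell `bsd-eis` (home `run/shared/lean/pub/bsd-eis/`), LEAD seat `bsd-line-x1-p1` (gen 5). The registered stub 3a-B of the
skeleton `Cruxes/GoodLatticeBDPValue/Lines/halves.lean` (v21, sha256 dadbf9cb…), STATEMENT VERBATIM: for `W/ℚ` globally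
minimal and `p = 3` a good prime with `E[3]` reducible, `E` has an additive prime, or a multiplicative prime `ℓ` that is
split with `ℓ ≡ 1 (mod 3)` or non-split with `ℓ + 1 ≡ 0 (mod 3)` — a «full Eisenstein descent datum» at `3` (Kriz 2016
Thm. 34/35; for semistable curves this is the `ℓ = 3`, `𝒪_f = ℤ` shadow of Ribet–Yoo's level-raising necessity, and the
content of Ohta 2014 Prop. (3.3.3)). PROOF = the elementary Galois-module road inside `E[9]` of the width seats' memo
`HOME/line-x1-p1-w3-g4/AN3-StubB-elementary-road.md` (no Hecke algebras), kernel-checked end to end, UNCONDITIONAL (no named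
fact): the LEAD's assembly `FullDescentAssembly.fullDescentAtThreeOfRed_of_pieces` (p656167) fed — through w2 gen 5's
`FullDescentSpecPieces.fullDescentAtThreeOfRed_of_theoremA` (p657273: Lemma S′ `lemmaS_spec` + Theorem B
`FullDescentTheoremB.exists_omega_point_of_fixed_point` p656782) — with Theorem A `FullDescentTheoremA.theoremA` (A-I p657261,
A-II p658062). Bricks by the width seats w2 gen 5 (Kummer splitting, (G-ℚ), Lemma S′, unipotent inertia), w3 gen 4 (Tate
bases and the level-3/9 algebra, ordinary lines, Frobenius end-game, Minkowski), w4 gen 5/6 (Weil determinant, ordinary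
kernels at 3, uniqueness), x2-p1-w7 (line characters at multiplicative places), and the tree (Mazur 1978 §5, Serre 1972,
Néron–Ogg–Shafarevich, Tate uniformisation — all DISCHARGED theorems).

HONEST FRAMING: this closes ONE registered stub of crux 2; the crux `GoodLatticeBDPValue` itself still rests on the four
PUBLISHED named-fact bundles and the PRE stub 3a-A `stub_anacongOfFullDescentDatum` (CGLS 2.2.1/2.2.2 + Kriz + Hida given
the datum). No summit statement, no BSD / IMC / Keller–Yin theorem is proved here. References: [Kriz2016] Thm. 34 (1)–(3),
Thm. 35, Def. 31, Rem. 32; [Ohta2014] Prop. (3.3.3); [Serre1972] §1.11–1.12; [Mazur1978] §5; [SilvermanATAEC1994] V.3–V.5.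
-/

set_option autoImplicit false

-- the route's Theorems namespace repeats the summit name by design (D-0017 nested layout)
set_option linter.dupNamespace false

noncomputable section

open scoped Classical NumberField

namespace Summit.BirchSwinnertonDyer.BirchSwinnertonDyer.Theorems.GoodLatticeBDPValueFullDescentStub

open NumberField IsDedekindDomain Field WeierstrassCurve
  Literature.NumberTheory.EllipticCurves Literature.NumberTheory.GaloisRepresentations
  Literature.NumberTheory.EllipticCurves.Rank1Residual

/-- **Stub 3a-B of halves v21 — `stub_fullDescentAtThreeOfRed` (Theorem T′), PROVED** (registered statement verbatim;
unconditional): `E/ℚ` globally minimal, `p = 3` good, `E[3]` reducible ⟹ an additive prime, or a multiplicative `ℓ` split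
with `ℓ ≡ 1 (mod 3)` or non-split with `ℓ + 1 ≡ 0 (mod 3)`. Proof: `FullDescentSpecPieces.fullDescentAtThreeOfRed_of_theoremA`
applied to `FullDescentTheoremA.theoremA`. [cite: Kriz2016, Thm. 34 (1)–(3), Thm. 35, Def. 31, Rem. 32]
[cite: Ohta2014, Prop. (3.3.3)] [cite: Serre1972, §1.11 Prop. 11–12, §1.12] [cite: Mazur1978, §5 (pp. 148–152)] -/
theorem stub_fullDescentAtThreeOfRed :
  ∀ (W : WeierstrassCurve ℚ) [W.IsElliptic] [W.IsGloballyMinimal] (p : ℕ) [Fact p.Prime],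
    p = 3 → Good W p → Red W p →
    ((∃ (ℓ : ℕ) (hℓ : ℓ.Prime), haveI : Fact ℓ.Prime := ⟨hℓ⟩; Addv W ℓ) ∨
      (∃ (ℓ : ℕ) (hℓ : ℓ.Prime), haveI : Fact ℓ.Prime := ⟨hℓ⟩;
        W.HasMultiplicativeReductionAtPrime ℓ ∧
          ((W.HasSplitMultiplicativeReductionAtPrime ℓ ∧ ℓ ≡ 1 [MOD p]) ∨
            (¬ W.HasSplitMultiplicativeReductionAtPrime ℓ ∧ ℓ + 1 ≡ 0 [MOD p])))) :=
  FullDescentSpecPieces.fullDescentAtThreeOfRed_of_theoremA FullDescentTheoremA.theoremA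

end Summit.BirchSwinnertonDyer.BirchSwinnertonDyer.Theorems.GoodLatticeBDPValueFullDescentStub

end
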